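import Literature.Claims.NS.ClayVariants
import Literature.Analysis.Convex.SchauderFixedPoint
import HarnessLib

/-!
# Claim skeleton C31 `GeorgievDavidi2021` — S. G. Georgiev & G. Davidi, «Existence and Smoothness of
# Navier-Stokes Equations», arXiv:1806.10081 **v10** (18 Jan 2021), incompressible-NS paper = bundle pp. 1–26

UNREFEREED/DISPUTED CLAIM under adjudication (cell `ns-claims`, D-0090 NS-CLAIMS SWEEP; typist
`ns-claims-typist-4`; referee lane `ns-claims-ref-3` unless re-pointed; refuter lane assigned by the lead).
**Nothing in this file asserts a step**: the claimed theorem and every load-bearing step are `Prop`-valued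
definitions; the only theorems are the kernel composition (pure logic), the Clay link, and two kernel remarks on
the printed setting. Bib key `GeorgievDavidi2018` (arXiv record, url = v10; lit-3 commit c4cc2c870549). TEXT
TYPED = arXiv v10, PDF pages 1–26 (the NS paper of the four-paper bundle, dated «Mon Dec 14 2020» on p.1), read
from the decoded page texts `sources/GeorgievDavidi2024/decoded-typist4/v10-text/p00NN.txt` (the PDF's math
font names its glyphs by Cambria-Math glyph index; decoder + glyph table + renders in that folder's README).
Locators «p.N l.M» = PDF page N of v10, line M of the decoded page text. The PINNED journal version Filomat 38(9)
(2024) 2965–2982 §4 (`GeorgievDavidi2024`; Schaefer-continuation variant of the same device, weighted sup-norm on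
all of `[0,∞)×ℝ³`, plus a «two non-negative solutions» cone argument) is NOT typed here: its displays are not
legible on the hub (WANTED acq-11535); CARD §1 records the relation, a DELTA follows when it lands.

## Claimed statement (v10 Theorem 1.1, p.3 l.13 – p.4 l.61; verbatim modulo layout)

«Let u₀, v₀, w₀ ∈ C^∞(ℝ³) be such that u₀|_{D_j}, v₀|_{D_j}, w₀|_{D_j} ∈ 𝒞₀^∞(D_j), supp(u₀|_{D_j}),
supp(v₀|_{D_j}), supp(w₀|_{D_j}) ⊂ D_jj, j ∈ {1,2,…}, and
|∂_x^{α₁}∂_y^{α₂}∂_z^{α₃}u₀(x,y,z)| ≤ C_{α₁α₂α₃K}(1+√(x²+y²+z²))^{−K} [same for v₀, w₀] (1.2) on ℝ³, for any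
α₁, α₂, α₃ ∈ ℕ₀ and positive constant K, ‖u₀‖_{L²(ℝ³)} ≤ 1, ‖v₀‖_{L²(ℝ³)} ≤ 1, ‖w₀‖_{L²(ℝ³)} ≤ 1,
sup_{(x,y,z)∈D_j}|u₀(x,y,z)| < 1/(2^{j²}√μ(D_j)), [the same bound for u₀ₓ, u₀ₓₓ, u₀_y, u₀_yy, u₀_z, u₀_zz,
and for v₀, w₀ with their first and second pure derivatives], j ∈ ℕ. Then the problem (1.1) has a solution
(u,v,w,p) ∈ (C([0,∞)×ℝ³))⁴ such that ∫_{ℝ³}|u(t,x,y,z)|² dxdydz ≤ C₁, [same for v, w, p] for some constant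
C₁ > 1 and for any t ∈ [0,∞).» Standing setting (p.2 l.15 – p.3 l.8): ρ = ν = 1 «without loss of
generality»; ℝ³ = ∪_{j≥1} D_j with D_j bounded and (1.) pairwise disjoint, (2.) «D_j and D_{j+1} are
adjoining» (not defined in print), (3.) the slice-measure conditions μ(D_{jx₁}) ≤ μ(D_j), μ(D_{jy₁}) ≤ μ(D_j),
μ(D_{jz₁}) ≤ μ(D_j), μ(D_{jx₁y₁}) ≤ μ(D_j), μ(D_{jx₁z₁}) ≤ μ(D_j), μ(D_{jy₁z₁}) ≤ μ(D_j), (4.) «D_jj is a compact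
subset of D_j such that D_jj ≠ D_j and there exists (x₀,y₀,z₀) ∈ ∂D_jj so that if (x₁,y₁,z₁) ∈ D_jj, then
[x₀,x₁]×[y₀,y₁]×[z₀,z₁] ∩ D_jj = ∅» (the box clause is contradictory as printed — kernel remark
`cond4Box_false`; typed charitably: the base point `(x₀,y₀,z₀) ∈ ∂D_jj` is kept, the box clause dropped).
Problem (1.1) (p.1): the 3D incompressible NS system for (u,v,w,p) on (0,∞)×ℝ³ with f ≡ 0 and data (u₀,v₀,w₀)
(no divergence-free hypothesis on the data is printed). The proof's last page adds (p.23 l.48–50): the patched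
solution «belongs to the space (C²([0,∞)×ℝ³))⁴. Using the system (1.1) we have that
(u,v,w,p) ∈ (C^∞([0,∞)×ℝ³))⁴», and «supp u, supp v, supp w, supp p ⊂ D₁₁ ∪ D₂₂ ∪ …». Remark 1.2 (p.4 l.63–64):
«If u₀ ≡ 0, v₀ ≡ 0, w₀ ≡ 0, then we obtain a nontrivial solution of the system (1.1).» (recorded, not typed).

TYPED RENDERING. `ℝ³ = EuclideanSpace ℝ (Fin 3)` (coordinates `x 0, x 1, x 2` = the print's `x, y, z`); the
data triple is one field `U₀ : ℝ³ → ℝ³` (components `u₀ v₀ w₀`), the solution one velocity `U : ℝ → ℝ³ → ℝ³`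
and one pressure `P : ℝ → ℝ³ → ℝ` in the tree's Clay vocabulary (`IsNavierStokesSolution 1 0 U₀ U P`,
`IsSmoothOnHalfSpace`, `HasBoundedEnergy`); cells are indexed by `ℕ` — cell `j` here is the print's cell
`j+1`, so the print's constant `2^{j²}` reads `2^{(j+1)²}`; (1.2) is the tree's `HasRapidSpatialDecay` (full
Fréchet derivatives and `(1+‖x‖)^K`, the same class as the printed mixed partials with `(1+√(x²+y²+z²))^{−K}`).
Inside a cell the paper's scalar unknowns are `ℝ → ℝ³ → ℝ`; partial derivatives `f_x, f_xx, …` are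
`pd k`, `pd k ∘ pd k` (Fréchet derivative along `EuclideanSpace.single k 1`; the classes carry the
differentiability the print assumes, so no junk `fderiv` is ever read); `f_t` on `[a,a+1]` is the one-sided
`derivWithin … (Icc a (a+1))`. Norm-balls `{‖f‖ ≤ R}` are typed pointwise (`NormLe`), never via `sSup`.

## Clay delta (reference `Literature.Claims.NS.ClayVariants`; CARD §3)

Nearest Clay statement (A) = `ClayVariants.clayR3.Regularity`. Δ1 ℝ³ «=»; Δ2 «=» (ν = 1 ⇔ all ν:
`ClayVariants.clayR3_regularityAt_iff`); Δ3 f ≡ 0 «=»; **Δ4 DATA CLASS MUCH NARROWER than Clay (4)**: besides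
rapid decay the datum must vanish identically outside the compact cores D_jj of ONE fixed decomposition of ℝ³
into bounded cells and obey the cell-wise smallness bounds — `clay_of_claimed` is NOT provable; the typed delta
is `ClayDelta` (every Clay datum is admissible for some admissible decomposition), with
`clay_of_claimed_of_delta : ClayDelta → ClaimedTheorem → clayR3.Regularity` proved; Δ5 «=» as typed (C^∞ on
[0,∞)×ℝ³ and sup_t ∫|u|² ≤ C₁ — the authors' own p.23 upgrade of the printed (C([0,∞)×ℝ³))⁴); Δ6 existence
only «=»; Δ7 «=»; Δ8 n/a.

## Step index (print/dependency order; HYGIENE 11) — `claim_of_steps` takes them in this order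

* Step 1 = `Theorem22` — Thm 2.2 p.5 l.3–12, the expansive Krasnosel'skii fixed-point theorem quoted from
  «[7] T. Xiang, R. Yuan, Nonlinear Analysis 71 (2009) 3229–3239, Theorem 2.4» (external published theorem,
  typed in full abstract generality over real Banach spaces in `Type`).
* Step 2 = `Theorem23_of_22` — Thm 2.3 p.5 l.14–25 «a consequence of Theorem 2.2», proof p.5 l.27 – p.6 l.25.
* Step 3 = `Lemma32` — Lemma 3.2 p.9 l.14–28, proof p.9 l.30 – p.11 l.29 (and its restatement for [1,2], p.17 (end) – p.18 l.28):
  a solution of the integrated system I_k = 0 (k = 1..4) in the class (C¹([a,a+1],C₀²(D_j)))⁴ solves (3.2)/(3.8).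
* Step 4 = `Step4_compact` — p.12 l.9–11 «By the construction of X¹ and Y¹, we have that X¹ is a compact subset
  of Y¹ and Y¹ is a compact subset of C¹([0,1],C₀²(D_j))» (and p.18 l.61 «Note that X² is a compact subset of
  Y²»), with the sets of p.11 l.33 – p.12 l.7; cell-grain companion `Step4Cell` (HYGIENE 13) and
  `step4_of_cell : Step4Cell → Step4_compact`. PREDICTED FIRST FAILING STEP (CARD §4).
* Step 5 = `Step5_mapsInto` — p.12 l.1–4 (choice of ε), p.12 l.34 – p.13 l.17 (the estimates
  ‖I^{1j}_1‖ ≤ (3M²+5M+N)μ(D_j)², ‖S^{1j}_k‖ ≤ (1+ε)M, «S^{1j}: X¹×X¹×X¹×X¹ → Y¹×Y¹×Y¹×Y¹ and it is continuous»).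
* Step 6 = `Step6_fixedPoint` — p.13 l.18–56, p.14 l.1–11 (+ p.19 – p.20 l.22): «T^{1j} … is an expansive operator with
  constant 1+ε … onto. From here and from Theorem 2.3, it follows that the operator T^{1j}+S^{1j} has a fixed
  point (u₁,v₁,w₁,p₁) in X¹×X¹×X¹×X¹ … whereupon I^{1j}_k(u₁,v₁,w₁,p₁) = 0» — typed as the printed INFERENCE
  (implicit: the instantiation of Thm 2.3, incl. its hypotheses «E Banach» and «{x − z : x ∈ X, z ∈ S(X)} ⊂ Y»,
  which the print does not verify).
* Step 7 = `Step7_gluing` — p.14 l.9–11, p.16 l.1 – p.23 l.19: time stepping on [1,2], [2,3], … and C¹-matching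
  at t = 1, 2, … («Consequently (u^j,v^j,w^j,p^j) … belongs to (C¹([0,∞),C₀²(D_j)))⁴ and it is a solution to
  the problem (3.2)», p.23 l.1–19), via Lemma 3.2 — typed as the printed inference.
* Step 8 = `Step8_patching` — p.23 l.20 – p.24 l.1: spatial patching of the cell solutions, «is a solution to
  the problem (1.1) … (C²([0,∞)×ℝ³))⁴. Using the system (1.1) we have … (C^∞([0,∞)×ℝ³))⁴», and the L² bounds
  — typed as the printed inference.

COMPOSITION: proved as `claim_of_steps` (pure logic: Step 8 ∘ Step 7 ∘ Step 6 ∘ (Step 2 Step 1), consuming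
Steps 3, 4, 5 at each cell/interval).

WHAT THIS IS NOT: not a claim about NS regularity or blow-up; not a claim about any author beyond the typed
locator.
-/

open scoped ContDiff ENNReal Topology
open _root_.MeasureTheory _root_.Set _root_.Filter

namespace Literature.Claims.NS.GeorgievDavidi2021

open Literature.Analysis.FluidPDE

noncomputable section

/-! ## Coordinates, partial derivatives, iterated primitives -/

/-- The point of `ℝ³` with coordinates `(a, b, c)`. [cite: GeorgievDavidi2018, §1 p.1 (coordinates x,y,z)] -/
def mk3 (a b c : ℝ) : EuclideanSpace ℝ (Fin 3) :=
  (EuclideanSpace.equiv (Fin 3) ℝ).symm ![a, b, c]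

/-- Replace the `k`-th coordinate of `x` by `s`. [cite: GeorgievDavidi2018, §3 p.7 (integration variables α, β, γ)] -/
def setCoord (x : EuclideanSpace ℝ (Fin 3)) (k : Fin 3) (s : ℝ) : EuclideanSpace ℝ (Fin 3) :=
  (EuclideanSpace.equiv (Fin 3) ℝ).symm (Function.update (EuclideanSpace.equiv (Fin 3) ℝ x) k s)

/-- First partial derivative `∂_k g` of a scalar field (`g_x, g_y, g_z` of the print), via the Fréchet
derivative along the `k`-th unit vector (junk `0` only where `g` is not differentiable; every class below
carries the differentiability the print assumes). [cite: GeorgievDavidi2018, norm display p.11 l.36–48] -/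
def pd (k : Fin 3) (g : EuclideanSpace ℝ (Fin 3) → ℝ) (x : EuclideanSpace ℝ (Fin 3)) : ℝ :=
  fderiv ℝ g x (EuclideanSpace.single k (1 : ℝ))

/-- One primitive in the `k`-th variable from the base value `c`:
`(prim k c g)(x) = ∫_c^{x_k} g(x with k-th coordinate s) ds` (the print's `∫_{x₀}^{x} … dα` etc.).
[cite: GeorgievDavidi2018, operators I^{1j} pp.7–9] -/
def prim (k : Fin 3) (c : ℝ) (g : EuclideanSpace ℝ (Fin 3) → ℝ) (x : EuclideanSpace ℝ (Fin 3)) : ℝ :=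
  ∫ s in c..x k, g (setCoord x k s)

/-- Iterated primitives from the base point `b = (x₀,y₀,z₀)`: `nx` primitives in `x`, `ny` in `y`, `nz` in
`z` (innermost `z`, as printed: `∫_{x₀}^{x}∫_{x₀}^{x₁}∫_{y₀}^{y}∫_{y₀}^{y₁}∫_{z₀}^{z}∫_{z₀}^{z₁} g dγdz₁dβdy₁dαdx₁`
is `box b 2 2 2 g`). [cite: GeorgievDavidi2018, operators I^{1j} pp.7–9] -/
def box (b : EuclideanSpace ℝ (Fin 3)) (nx ny nz : ℕ) (g : EuclideanSpace ℝ (Fin 3) → ℝ) :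
    EuclideanSpace ℝ (Fin 3) → ℝ :=
  (prim 0 (b 0))^[nx] ((prim 1 (b 1))^[ny] ((prim 2 (b 2))^[nz] g))

/-! ## The standing setting: the decomposition `ℝ³ = ∪ D_j` (conditions 1.–4., p.2 l.17 – p.3 l.8) -/

/-- An ADMISSIBLE DECOMPOSITION of `ℝ³` (p.2 l.17 – p.3 l.8): bounded cells `D j` covering `ℝ³`, pairwise
disjoint (1.), «D_j and D_{j+1} adjoining» (2. — the word is not defined in print and never used in the proof;
typed as an uninterpreted relation `adjoining`, which imposes nothing), the slice-measure conditions (3.), and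
(4.) a compact core `Djj j ⊆ D j`, `Djj j ≠ D j`, with a base point `base j ∈ ∂(Djj j)` — the lower limits
`(x₀,y₀,z₀)` of all the integrals of §3. The printed box clause of (4.) is dropped (it is unsatisfiable as
printed: `cond4Box_false`). Measurability of `D j` and `0 < μ(D j)` are the silent hypotheses of
`M_{1j} = 1/(2^{j²}√μ(D_j))` (p.11 l.52–54). Cells indexed by `ℕ`: cell `j` = the print's cell `j+1`.
[cite: GeorgievDavidi2018, conditions 1.–4. p.2 l.17 – p.3 l.8] -/
structure Decomposition where
  /-- the cells `D_j` -/
  D : ℕ → Set (EuclideanSpace ℝ (Fin 3))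
  /-- the compact cores `D_jj ⊆ D_j` -/
  Djj : ℕ → Set (EuclideanSpace ℝ (Fin 3))
  /-- the base points `(x₀,y₀,z₀) ∈ ∂D_jj` -/
  base : ℕ → EuclideanSpace ℝ (Fin 3)
  /-- «adjoining» (2.), uninterpreted -/
  adjoining : ℕ → ℕ → Prop
  /-- `ℝ³ = ∪_j D_j` -/
  cover : ∀ x : EuclideanSpace ℝ (Fin 3), ∃ j, x ∈ D j
  /-- the cells are bounded -/
  bounded : ∀ j, Bornology.IsBounded (D j)
  /-- the cells are (Lebesgue) measurable (silent) -/
  measurable : ∀ j, MeasurableSet (D j)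
  /-- `μ(D_j) > 0` (silent: `M_{1j}` divides by `√μ(D_j)`) -/
  vol_pos : ∀ j, 0 < volume (D j)
  /-- (1.) `D_i ∩ D_j = ∅` for `i ≠ j` -/
  disjoint : ∀ i j, i ≠ j → Disjoint (D i) (D j)
  /-- (2.) `D_j` and `D_{j+1}` are «adjoining» -/
  adj : ∀ j, adjoining j (j + 1)
  /-- (3.) 2D slices through any point of `D_j`: `μ(D_{jx₁}) ≤ μ(D_j)` -/
  slice_x : ∀ j, ∀ p ∈ D j,
    volume {q : EuclideanSpace ℝ (Fin 2) | mk3 (p 0) (q 0) (q 1) ∈ D j} ≤ volume (D j)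
  /-- (3.) `μ(D_{jy₁}) ≤ μ(D_j)` -/
  slice_y : ∀ j, ∀ p ∈ D j,
    volume {q : EuclideanSpace ℝ (Fin 2) | mk3 (q 0) (p 1) (q 1) ∈ D j} ≤ volume (D j)
  /-- (3.) `μ(D_{jz₁}) ≤ μ(D_j)` -/
  slice_z : ∀ j, ∀ p ∈ D j,
    volume {q : EuclideanSpace ℝ (Fin 2) | mk3 (q 0) (q 1) (p 2) ∈ D j} ≤ volume (D j)
  /-- (3.) 1D slices: `μ(D_{jx₁y₁}) ≤ μ(D_j)` -/
  slice_xy : ∀ j, ∀ p ∈ D j, volume {s : ℝ | mk3 (p 0) (p 1) s ∈ D j} ≤ volume (D j)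
  /-- (3.) `μ(D_{jx₁z₁}) ≤ μ(D_j)` -/
  slice_xz : ∀ j, ∀ p ∈ D j, volume {s : ℝ | mk3 (p 0) s (p 2) ∈ D j} ≤ volume (D j)
  /-- (3.) `μ(D_{jy₁z₁}) ≤ μ(D_j)` -/
  slice_yz : ∀ j, ∀ p ∈ D j, volume {s : ℝ | mk3 s (p 1) (p 2) ∈ D j} ≤ volume (D j)
  /-- (4.) `D_jj` compact -/
  compact : ∀ j, IsCompact (Djj j)
  /-- (4.) `D_jj ⊆ D_j` -/
  core_sub : ∀ j, Djj j ⊆ D j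
  /-- (4.) `D_jj ≠ D_j` -/
  core_ne : ∀ j, Djj j ≠ D j
  /-- (4.) `(x₀,y₀,z₀) ∈ ∂D_jj` -/
  base_mem : ∀ j, base j ∈ frontier (Djj j)

/-- The printed box clause of condition (4.) p.3 l.4–8, VERBATIM: «there exists (x₀,y₀,z₀) ∈ ∂D_jj so that if
(x₁,y₁,z₁) ∈ D_jj, then [x₀,x₁]×[y₀,y₁]×[z₀,z₁] ∩ D_jj = ∅, where [x₀,x₁] is the segment with end points x₀
and x₁ …», for a core `K = D_jj` and a base point `b = (x₀,y₀,z₀)` (segments = unordered intervals `uIcc`).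
Recorded, not used: see `cond4Box_false`. [cite: GeorgievDavidi2018, condition 4. p.3 l.4–8] -/
def Cond4BoxAsPrinted (K : Set (EuclideanSpace ℝ (Fin 3))) (b : EuclideanSpace ℝ (Fin 3)) : Prop :=
  b ∈ frontier K ∧ ∀ q ∈ K,
    {x : EuclideanSpace ℝ (Fin 3) | x 0 ∈ uIcc (b 0) (q 0) ∧ x 1 ∈ uIcc (b 1) (q 1) ∧
      x 2 ∈ uIcc (b 2) (q 2)} ∩ K = ∅

/-- KERNEL REMARK on the printed setting: the box clause of (4.) cannot hold for a non-empty core — the point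
`(x₁,y₁,z₁) ∈ D_jj` itself lies in the box `[x₀,x₁]×[y₀,y₁]×[z₀,z₁]`. (This is why `Decomposition` keeps only
the base point of (4.); the clause plays no role in the printed proof.)
[cite: GeorgievDavidi2018, condition 4. p.3 l.4–8] -/
theorem cond4Box_false {K : Set (EuclideanSpace ℝ (Fin 3))} {b : EuclideanSpace ℝ (Fin 3)}
    (hK : K.Nonempty) : ¬ Cond4BoxAsPrinted K b := by
  rintro ⟨-, h⟩
  obtain ⟨q, hq⟩ := hK
  have hmem : q ∈ {x : EuclideanSpace ℝ (Fin 3) | x 0 ∈ uIcc (b 0) (q 0) ∧ x 1 ∈ uIcc (b 1) (q 1) ∧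
      x 2 ∈ uIcc (b 2) (q 2)} ∩ K :=
    ⟨⟨right_mem_uIcc, right_mem_uIcc, right_mem_uIcc⟩, hq⟩
  rw [h q hq] at hmem
  simp at hmem

/-- `M_{1j} := 1/(2^{j²}√μ(D_j))` (p.11 l.52–54; the same bound `M_j` on every later interval, p.18 l.54),
for cell `j` (= print's `j+1`). [cite: GeorgievDavidi2018, definition of X¹ and M_{1j} p.11 l.52–54] -/
def M (𝒟 : Decomposition) (j : ℕ) : ℝ :=
  1 / (2 ^ ((j + 1) ^ 2) * Real.sqrt (volume (𝒟.D j)).toReal)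

/-! ## The data class of Theorem 1.1 (p.3 l.13 – p.4 l.52) -/

/-- The hypotheses of Theorem 1.1 on the datum `U₀ = (u₀,v₀,w₀)` relative to the decomposition `𝒟`:
smooth; rapid decay (1.2); on each cell the restriction is supported in the core `D_jj` («u₀|_{D_j} ∈ 𝒞₀^∞(D_j),
supp(u₀|_{D_j}) ⊂ D_jj»); `‖u₀‖_{L²} ≤ 1` etc.; and the cell-wise STRICT bounds
`sup_{D_j}|g| < 1/(2^{j²}√μ(D_j))` for `g` each component and each of its first and second pure partial
derivatives. (No divergence-free hypothesis is printed.) [cite: GeorgievDavidi2018, Thm 1.1 p.3 l.13 – p.4 l.52] -/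
structure DataHyp (𝒟 : Decomposition)
    (U₀ : EuclideanSpace ℝ (Fin 3) → EuclideanSpace ℝ (Fin 3)) : Prop where
  /-- `u₀, v₀, w₀ ∈ C^∞(ℝ³)` -/
  smooth : ContDiff ℝ ∞ U₀
  /-- (1.2): rapid decay of all derivatives (Clay (4)) -/
  decay : HasRapidSpatialDecay U₀
  /-- `supp(u₀|_{D_j}) ⊂ D_jj` for every cell and component -/
  support : ∀ j, ∀ x ∈ 𝒟.D j, x ∉ 𝒟.Djj j → U₀ x = 0
  /-- `‖u₀‖_{L²(ℝ³)} ≤ 1`, `‖v₀‖ ≤ 1`, `‖w₀‖ ≤ 1` (as `∫ |g|² ≤ 1`) -/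
  l2 : ∀ i : Fin 3, ∫⁻ x, ‖U₀ x i‖ₑ ^ 2 ≤ 1
  /-- `sup_{D_j} |g| < M_{1j}` for each component `g` -/
  sup0 : ∀ j, ∀ i : Fin 3, ∀ x ∈ 𝒟.D j, |U₀ x i| < M 𝒟 j
  /-- `sup_{D_j} |g_x|, |g_y|, |g_z| < M_{1j}` -/
  sup1 : ∀ j, ∀ i k : Fin 3, ∀ x ∈ 𝒟.D j, |pd k (fun y => U₀ y i) x| < M 𝒟 j
  /-- `sup_{D_j} |g_xx|, |g_yy|, |g_zz| < M_{1j}` -/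
  sup2 : ∀ j, ∀ i k : Fin 3, ∀ x ∈ 𝒟.D j, |pd k (pd k (fun y => U₀ y i)) x| < M 𝒟 j

/-! ## The claimed theorem and the Clay link -/

/-- The CONCLUSION of Theorem 1.1 for the datum `U₀` (p.4 l.53–61 with p.23 l.20–50): a velocity `U` and a
pressure `P`, smooth on `[0,∞)×ℝ³` («Using the system (1.1) we have (u,v,w,p) ∈ (C^∞([0,∞)×ℝ³))⁴», p.23
l.48–50), solving (1.1) with `ρ = ν = 1`, `f ≡ 0`, datum `U₀` (tree `IsNavierStokesSolution 1 0 U₀ U P`), with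
`∫|u|², ∫|v|², ∫|w|² ≤ C₁` for all `t ≥ 0` (tree `HasBoundedEnergy U`, equivalent to the three componentwise
bounds) and `∫|p(t,·)|² ≤ C₁`, and supported in the cores: «supp u, supp v, supp w, supp p ⊂ D₁₁ ∪ D₂₂ ∪ …»
(p.23 l.51–52). [claim: GeorgievDavidi2018, status: disputed] [cite: GeorgievDavidi2018, Thm 1.1 p.4 l.53–61; p.23 l.20–52] -/
def Conclusion (𝒟 : Decomposition) (U₀ : EuclideanSpace ℝ (Fin 3) → EuclideanSpace ℝ (Fin 3)) : Prop :=
  ∃ (U : ℝ → EuclideanSpace ℝ (Fin 3) → EuclideanSpace ℝ (Fin 3)) (P : ℝ → EuclideanSpace ℝ (Fin 3) → ℝ),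
    IsSmoothOnHalfSpace U ∧ IsSmoothOnHalfSpace P ∧ IsNavierStokesSolution 1 0 U₀ U P ∧
      HasBoundedEnergy U ∧ (∃ C : ℝ≥0∞, C < ⊤ ∧ ∀ t : ℝ, 0 ≤ t → ∫⁻ x, ‖P t x‖ₑ ^ 2 ≤ C) ∧
      ∀ t : ℝ, 0 ≤ t → ∀ x : EuclideanSpace ℝ (Fin 3), (∀ j, x ∉ 𝒟.Djj j) → U t x = 0 ∧ P t x = 0

/-- **Theorem 1.1** (p.3 l.13 – p.4 l.61), typed: for every admissible decomposition and every datum of the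
printed class, the conclusion holds. [claim: GeorgievDavidi2018, status: disputed]
[cite: GeorgievDavidi2018, Thm 1.1 p.3 l.13 – p.4 l.61] -/
def ClaimedTheorem : Prop :=
  ∀ (𝒟 : Decomposition) (U₀ : EuclideanSpace ℝ (Fin 3) → EuclideanSpace ℝ (Fin 3)),
    DataHyp 𝒟 U₀ → Conclusion 𝒟 U₀

/-- The Clay-link DELTA (Δ4 DATA CLASS, `ClayVariants` §3): «every smooth, divergence-free, rapidly decaying
datum on ℝ³ satisfies the hypotheses of Theorem 1.1 for SOME admissible decomposition». This is what separates
the claimed statement from Clay (A); it is not asserted (and is false for data that vanish on no cell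
boundary — recorded in CARD §3, not used). [cite: GeorgievDavidi2018, Thm 1.1 hypotheses p.3 l.13 – p.4 l.52]
[cite: FeffermanClay2006, (A) with (4), p. 2] -/
def ClayDelta : Prop :=
  ∀ U₀ : EuclideanSpace ℝ (Fin 3) → EuclideanSpace ℝ (Fin 3), ContDiff ℝ ∞ U₀ →
    NSWave0.IsDivFree U₀ → HasRapidSpatialDecay U₀ → ∃ 𝒟 : Decomposition, DataHyp 𝒟 U₀

/-- Clay link: MODULO the data-class delta `ClayDelta`, the claimed theorem gives Clay (A) (at `ν = 1`, then
every `ν` by `ClayVariants.clayR3_regularityAt_iff`). `clay_of_claimed` itself is not provable (Δ4).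
[cite: GeorgievDavidi2018, Thm 1.1 p.3–4] [cite: FeffermanClay2006, (A) p. 2] -/
theorem clay_of_claimed_of_delta (hΔ : ClayDelta) (h : ClaimedTheorem) :
    ClayVariants.clayR3.Regularity := by
  rw [← ClayVariants.clayR3_regularityAt_iff one_pos]
  intro U₀ hs hdiv hdec
  obtain ⟨𝒟, hD⟩ := hΔ U₀ hs hdiv hdec
  obtain ⟨U, P, hU, hP, hsol, hE, -, -⟩ := h 𝒟 U₀ hD
  exact ⟨U, P, hU, hP, hsol, hE⟩

/-! ## Step 1 — Theorem 2.2 ([7], Thm 2.4), abstract -/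

/-- `T` is EXPANSIVE on `X` with a constant `h > 1`: `d(Tx,Ty) ≥ h·d(x,y)` for `x, y ∈ X` (Definition 2.1,
p.4 l.69 – p.5 l.1). [cite: GeorgievDavidi2018, Def 2.1 p.4 l.69 – p.5 l.1] -/
def IsExpansiveOn {E : Type} [NormedAddCommGroup E] (T : E → E) (X : Set E) : Prop :=
  ∃ h : ℝ, 1 < h ∧ ∀ x ∈ X, ∀ y ∈ X, h * dist x y ≤ dist (T x) (T y)

/-- **Step 1 — Theorem 2.2** (p.5 l.3–12; «([7], Theorem 2.4)» = Xiang–Yuan 2009): «Let X be a nonempty closed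
convex subset of a Banach space E. Suppose that T and S map X into E such that 1. S is continuous and S(X)
resides in a compact subset of E. 2. T : X → E is expansive. 3. S(X) ⊂ (I−T)(E) and [x = Tx + Sy, y ∈ X] ⇒
x ∈ X (or S(X) ⊂ (I−T)(X)). Then there exists a point x* ∈ X such that Sx* + Tx* = x*.» Typed in full
generality over real Banach spaces in `Type` (maps defined on all of `E`, hypotheses on `X`); condition 3 in
both printed forms (disjunction). [claim: GeorgievDavidi2018, status: disputed]
[cite: GeorgievDavidi2018, Thm 2.2 p.5 l.3–12] -/
def Theorem22 : Prop :=
  ∀ (E : Type) [NormedAddCommGroup E] [NormedSpace ℝ E] [CompleteSpace E] (X : Set E) (T S : E → E),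
    X.Nonempty → IsClosed X → Convex ℝ X →
    ContinuousOn S X → (∃ K : Set E, IsCompact K ∧ S '' X ⊆ K) →
    IsExpansiveOn T X →
    ((S '' X ⊆ (fun x => x - T x) '' univ ∧ ∀ x : E, ∀ y ∈ X, x = T x + S y → x ∈ X) ∨
      S '' X ⊆ (fun x => x - T x) '' X) →
    ∃ x ∈ X, S x + T x = x

/-! ## Step 2 — Theorem 2.3 from Theorem 2.2, abstract -/

/-- **Theorem 2.3** (p.5 l.15–25): «Let X be a nonempty closed convex subset of a Banach space E and Y is a
nonempty compact subset of E such that X ⊂ Y, Y ≠ X. Suppose that T and S map X into E such that 1. S is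
continuous and S(X) resides in Y. 2. T : X → E is linear, continuous and expansive, and T : X → Y is onto, and
{x − z : x ∈ X, z ∈ S(X)} ⊂ Y. Then there exists an x* ∈ X such that Tx* + Sx* = x*.» («linear» typed as: `T`
is (the restriction of) a continuous linear map of `E`.) [claim: GeorgievDavidi2018, status: disputed]
[cite: GeorgievDavidi2018, Thm 2.3 p.5 l.15–25] -/
def Theorem23 : Prop :=
  ∀ (E : Type) [NormedAddCommGroup E] [NormedSpace ℝ E] [CompleteSpace E] (X Y : Set E) (T S : E → E),
    X.Nonempty → IsClosed X → Convex ℝ X → IsCompact Y → X ⊆ Y → Y ≠ X →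
    ContinuousOn S X → S '' X ⊆ Y →
    (∃ L : E →L[ℝ] E, ∀ x, T x = L x) → IsExpansiveOn T X → T '' X = Y →
    (∀ x ∈ X, ∀ z ∈ S '' X, x - z ∈ Y) →
    ∃ x ∈ X, T x + S x = x

/-- **Step 2 — «The following result is a consequence of Theorem 2.2»** (p.5 l.14), with the printed proof
p.5 l.27 – p.6 l.25 (the iteration `y_{n+1} = T⁻¹y_n − z` in the compact `Y` showing `S(X) ⊂ (I−T)(X)`).
Typed as the printed implication. [claim: GeorgievDavidi2018, status: disputed]
[cite: GeorgievDavidi2018, Thm 2.3 and its proof p.5 l.14 – p.6 l.25] -/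
def Theorem23_of_22 : Prop := Theorem22 → Theorem23

/-! ## The function classes of §3 on one cell `D_j` and one time interval `[a, a+1]` -/

/-- `f ∈ C¹([a,a+1], C₀²(D_j))` with `supp_{(x,y,z)} f ⊂ D_jj` — the space `E¹` of p.11 l.33–35 (resp. the
space of p.18 l.30–32 on `[1,2]`), typed as: `f` is `C¹` in `(t,x)` on the slab (one-sided in `t`), `C²` in `x`
at each time, the pure first and second partials `f_x, f_xx, f_y, …` are continuous on the slab (these are the
quantities the norm of p.11 l.36–48 takes suprema of), and `f(t,·)` vanishes off the core `K = D_jj`.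
[cite: GeorgievDavidi2018, definition of E¹ p.11 l.33–35; p.18 l.30–32] -/
structure InE (K : Set (EuclideanSpace ℝ (Fin 3))) (a : ℝ) (f : ℝ → EuclideanSpace ℝ (Fin 3) → ℝ) :
    Prop where
  /-- `C¹` in `(t, x)` on `[a,a+1] × ℝ³` -/
  c1 : ContDiffOn ℝ 1 (Function.uncurry f) (Icc a (a + 1) ×ˢ univ)
  /-- `C²` in `x` at each time -/
  c2 : ∀ t ∈ Icc a (a + 1), ContDiff ℝ 2 (f t)
  /-- `f_x, f_y, f_z` continuous on the slab -/
  cont1 : ∀ k : Fin 3, ContinuousOn (fun q : ℝ × EuclideanSpace ℝ (Fin 3) => pd k (f q.1) q.2)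
    (Icc a (a + 1) ×ˢ univ)
  /-- `f_xx, f_yy, f_zz` continuous on the slab -/
  cont2 : ∀ k : Fin 3, ContinuousOn (fun q : ℝ × EuclideanSpace ℝ (Fin 3) => pd k (pd k (f q.1)) q.2)
    (Icc a (a + 1) ×ˢ univ)
  /-- `supp_{(x,y,z)} f ⊂ D_jj` -/
  support : ∀ t ∈ Icc a (a + 1), ∀ x, x ∉ K → f t x = 0

/-- `‖f‖ ≤ R` for the norm of p.11 l.36–48 (resp. p.18 l.33–52):
`‖f‖ = max{sup|f|, sup|f_t|, sup|f_x|, sup|f_xx|, sup|f_y|, sup|f_yy|, sup|f_z|, sup|f_zz|}`, suprema over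
`t ∈ [a,a+1]`, `(x,y,z) ∈ D_j` — typed pointwise (no `sSup`); `f_t` one-sided on `[a,a+1]`.
[cite: GeorgievDavidi2018, norm display p.11 l.36–48] -/
def NormLe (D : Set (EuclideanSpace ℝ (Fin 3))) (a : ℝ) (f : ℝ → EuclideanSpace ℝ (Fin 3) → ℝ)
    (R : ℝ) : Prop :=
  ∀ t ∈ Icc a (a + 1), ∀ x ∈ D,
    |f t x| ≤ R ∧ |derivWithin (fun s => f s x) (Icc a (a + 1)) t| ≤ R ∧
      ∀ k : Fin 3, |pd k (f t) x| ≤ R ∧ |pd k (pd k (f t)) x| ≤ R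

/-- `f ∈ X` on the cell `j` and the interval `[a,a+1]`: `X¹ = {f ∈ X̃¹ : ‖f‖ ≤ M_{1j}}` (p.11 l.52–54),
`X² = {f ∈ X̃² : ‖f‖ ≤ M_j}` (p.18 l.54), where `X̃ = ` closure of «the set of all equicontinuous families
of functions of the space E» `∪ {the initial slices}` (p.11 l.33, l.49; p.18 l.30, l.50). READING (recorded):
every single function of `E` is by itself an equicontinuous family, so «the set of all [members of]
equicontinuous families of E» is `E`, and the initial slices (t-independent, supported in `D_jj`) already
belong to `E`; the typed `X` is therefore the `‖·‖`-ball of radius `M` in `E` (the closure is accounted for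
in `CompactAt`, which asks only for Cauchy subsequences). [cite: GeorgievDavidi2018, X̃¹, X¹ p.11 l.33–54; X², Y² p.18 l.30–59] -/
def InX (𝒟 : Decomposition) (j : ℕ) (a : ℝ) (f : ℝ → EuclideanSpace ℝ (Fin 3) → ℝ) : Prop :=
  InE (𝒟.Djj j) a f ∧ NormLe (𝒟.D j) a f (M 𝒟 j)

/-- `f ∈ Y` on the cell `j` and `[a,a+1]`: `Y¹ = {f ∈ X̃¹ : ‖f‖ ≤ (1+ε)M_{1j}}` (p.12 l.7; `Y²` p.18 l.59).
[cite: GeorgievDavidi2018, Y¹ p.12 l.7; Y² p.18 l.59] -/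
def InY (𝒟 : Decomposition) (j : ℕ) (ε a : ℝ) (f : ℝ → EuclideanSpace ℝ (Fin 3) → ℝ) : Prop :=
  InE (𝒟.Djj j) a f ∧ NormLe (𝒟.D j) a f ((1 + ε) * M 𝒟 j)

/-- The choice of `ε` (p.12 l.1–4): «We take ε > 0 so that ε(3M_{1j}² + 6M_{1j} + N_{1j})(μ(D_j))² ≤ M_{1j}», with
`N_{1j} := max{sup_{D_j}|u₀|, sup_{D_j}|v₀|, sup_{D_j}|w₀|}` (p.11 l.56–57) — typed with `N` any common upper
bound of `|u₀|, |v₀|, |w₀|` on `D_j` (equivalent: the left side is monotone in `N`).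
[cite: GeorgievDavidi2018, N_{1j} p.11 l.56–57; choice of ε p.12 l.1–4] -/
def EpsAdmissible (𝒟 : Decomposition) (U₀ : EuclideanSpace ℝ (Fin 3) → EuclideanSpace ℝ (Fin 3))
    (j : ℕ) (ε : ℝ) : Prop :=
  0 < ε ∧ ∃ N : ℝ, (∀ x ∈ 𝒟.D j, ∀ i : Fin 3, |U₀ x i| ≤ N) ∧
    ε * (3 * M 𝒟 j ^ 2 + 6 * M 𝒟 j + N) * (volume (𝒟.D j)).toReal ^ 2 ≤ M 𝒟 j

/-! ## The integral operators `I^{mj}_k` (pp.7–9 for [0,1]; pp.16–17 for [1,2]; Remark 3.4 pp.24–25 in general) -/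

/-- `I^{mj}_1(u,v,w,p)(t,·)` on the interval starting at `a = m−1` with initial slice `ua = u_{m−1}(m−1,·)`
(`= u₀` for `m = 1`), base point `b`: the first momentum equation of (3.2) integrated once in `t` and twice in
each of `x, y, z` with the boundary terms dropped, p.7 l.23 – p.8 (m = 1), p.16 l.18 ff. (m = 2),
Remark 3.4 p.24 (general m). [cite: GeorgievDavidi2018, I^{1j}_1 p.7 l.23 – p.8; I^{mj}_1 Remark 3.4 p.24] -/
def Iop1 (b : EuclideanSpace ℝ (Fin 3)) (a : ℝ) (ua : EuclideanSpace ℝ (Fin 3) → ℝ)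
    (u v w p : ℝ → EuclideanSpace ℝ (Fin 3) → ℝ) (t : ℝ) (x : EuclideanSpace ℝ (Fin 3)) : ℝ :=
  box b 2 2 2 (fun y => u t y - ua y) x +
    ∫ s in a..t,
      (box b 1 2 2 (fun y => u s y ^ 2) x + box b 2 1 2 (fun y => u s y * v s y) x +
        box b 2 2 1 (fun y => u s y * w s y) x + box b 1 2 2 (p s) x -
        box b 0 2 2 (u s) x - box b 2 0 2 (u s) x - box b 2 2 0 (u s) x)

/-- `I^{mj}_2(u,v,w,p)(t,·)`: the second momentum equation integrated likewise, p.8 (m = 1),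
p.16 (end) – p.17 (m = 2). [cite: GeorgievDavidi2018, I^{1j}_2 p.8] -/
def Iop2 (b : EuclideanSpace ℝ (Fin 3)) (a : ℝ) (va : EuclideanSpace ℝ (Fin 3) → ℝ)
    (u v w p : ℝ → EuclideanSpace ℝ (Fin 3) → ℝ) (t : ℝ) (x : EuclideanSpace ℝ (Fin 3)) : ℝ :=
  box b 2 2 2 (fun y => v t y - va y) x +
    ∫ s in a..t,
      (box b 1 2 2 (fun y => u s y * v s y) x + box b 2 1 2 (fun y => v s y ^ 2) x +
        box b 2 2 1 (fun y => v s y * w s y) x + box b 2 1 2 (p s) x -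
        box b 0 2 2 (v s) x - box b 2 0 2 (v s) x - box b 2 2 0 (v s) x)

/-- `I^{mj}_3(u,v,w,p)(t,·)`: the third momentum equation integrated likewise, p.8 (m = 1),
p.17 (m = 2). [cite: GeorgievDavidi2018, I^{1j}_3 p.8] -/
def Iop3 (b : EuclideanSpace ℝ (Fin 3)) (a : ℝ) (wa : EuclideanSpace ℝ (Fin 3) → ℝ)
    (u v w p : ℝ → EuclideanSpace ℝ (Fin 3) → ℝ) (t : ℝ) (x : EuclideanSpace ℝ (Fin 3)) : ℝ :=
  box b 2 2 2 (fun y => w t y - wa y) x +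
    ∫ s in a..t,
      (box b 1 2 2 (fun y => u s y * w s y) x + box b 2 1 2 (fun y => v s y * w s y) x +
        box b 2 2 1 (fun y => w s y ^ 2) x + box b 2 2 1 (p s) x -
        box b 0 2 2 (w s) x - box b 2 0 2 (w s) x - box b 2 2 0 (w s) x)

/-- `I^{mj}_4(u,v,w,p)(t,·)`: the divergence equation integrated once in `t` and (1,2,2)/(2,1,2)/(2,2,1) times
in `(x,y,z)`, p.8 (last display) – p.9 l.8 (m = 1), p.17 (last display) (m = 2). [cite: GeorgievDavidi2018, I^{1j}_4 p.8 – p.9 l.8] -/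
def Iop4 (b : EuclideanSpace ℝ (Fin 3)) (a : ℝ)
    (u v w : ℝ → EuclideanSpace ℝ (Fin 3) → ℝ) (t : ℝ) (x : EuclideanSpace ℝ (Fin 3)) : ℝ :=
  ∫ s in a..t, (box b 1 2 2 (u s) x + box b 2 1 2 (v s) x + box b 2 2 1 (w s) x)

/-- `(u,v,w,p)` SOLVES THE INTEGRATED SYSTEM `I^{mj}_k(u,v,w,p) = 0`, `k = 1,2,3,4`, on `[a,a+1] × D_j` with
initial slices `(ua, va, wa)` — (3.3) p.9 l.14–27 (m = 1), (3.9) p.18 l.1–8 (m = 2).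
[cite: GeorgievDavidi2018, (3.3) p.9 l.14–27; (3.9) p.18 l.1–8] -/
def SolvesIntegrated (𝒟 : Decomposition) (j : ℕ) (a : ℝ) (ua va wa : EuclideanSpace ℝ (Fin 3) → ℝ)
    (u v w p : ℝ → EuclideanSpace ℝ (Fin 3) → ℝ) : Prop :=
  ∀ t ∈ Icc a (a + 1), ∀ x ∈ 𝒟.D j,
    Iop1 (𝒟.base j) a ua u v w p t x = 0 ∧ Iop2 (𝒟.base j) a va u v w p t x = 0 ∧
      Iop3 (𝒟.base j) a wa u v w p t x = 0 ∧ Iop4 (𝒟.base j) a u v w t x = 0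

/-- `(u,v,w,p)` SOLVES THE CELL PROBLEM (3.2) (p.7 l.7–18; (3.8) p.16 l.1–12 on the next interval) classically:
the three momentum equations in the form `u_t + (u²)_x + (uv)_y + (uw)_z + p_x − u_xx − u_yy − u_zz = 0` etc.
and `u_x + v_y + w_z = 0` «in (a, a+1] × D_j», with the initial slices at `t = a` on `D_j`; `ρ = ν = 1`.
[cite: GeorgievDavidi2018, (3.2) p.7 l.7–18; (3.8) p.16 l.1–12] -/
def SolvesCellNS (𝒟 : Decomposition) (j : ℕ) (a : ℝ) (ua va wa : EuclideanSpace ℝ (Fin 3) → ℝ)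
    (u v w p : ℝ → EuclideanSpace ℝ (Fin 3) → ℝ) : Prop :=
  (∀ t ∈ Ioc a (a + 1), ∀ x ∈ 𝒟.D j,
    derivWithin (fun s => u s x) (Icc a (a + 1)) t + pd 0 (fun y => u t y ^ 2) x +
        pd 1 (fun y => u t y * v t y) x + pd 2 (fun y => u t y * w t y) x + pd 0 (p t) x -
        pd 0 (pd 0 (u t)) x - pd 1 (pd 1 (u t)) x - pd 2 (pd 2 (u t)) x = 0 ∧
    derivWithin (fun s => v s x) (Icc a (a + 1)) t + pd 0 (fun y => u t y * v t y) x +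
        pd 1 (fun y => v t y ^ 2) x + pd 2 (fun y => v t y * w t y) x + pd 1 (p t) x -
        pd 0 (pd 0 (v t)) x - pd 1 (pd 1 (v t)) x - pd 2 (pd 2 (v t)) x = 0 ∧
    derivWithin (fun s => w s x) (Icc a (a + 1)) t + pd 0 (fun y => u t y * w t y) x +
        pd 1 (fun y => v t y * w t y) x + pd 2 (fun y => w t y ^ 2) x + pd 2 (p t) x -
        pd 0 (pd 0 (w t)) x - pd 1 (pd 1 (w t)) x - pd 2 (pd 2 (w t)) x = 0 ∧
    pd 0 (u t) x + pd 1 (v t) x + pd 2 (w t) x = 0) ∧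
  ∀ x ∈ 𝒟.D j, u a x = ua x ∧ v a x = va x ∧ w a x = wa x

/-! ## Step 3 — Lemma 3.2 -/

/-- **Step 3 — Lemma 3.2** (p.9 l.14–28, proof p.9 l.30 – p.11 l.29; restated for `[1,2]` on p.17 (end) – p.18 l.28): «Every
solution (u,v,w,p) ∈ (C¹([0,1],C₀²(D_j)))⁴ of the system (3.3) is a solution of the problem (3.2)» (proof:
differentiate `I^{1j}_k = 0` once in `t` and twice in `x, y, z`; put `t = 0` for the initial condition).
Typed for every cell, every interval `[a,a+1]` and all initial slices. [claim: GeorgievDavidi2018, status: disputed]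
[cite: GeorgievDavidi2018, Lemma 3.2 p.9 l.14 – p.11 l.29] -/
def Lemma32 : Prop :=
  ∀ (𝒟 : Decomposition) (j : ℕ) (a : ℝ) (ua va wa : EuclideanSpace ℝ (Fin 3) → ℝ)
    (u v w p : ℝ → EuclideanSpace ℝ (Fin 3) → ℝ),
    InE (𝒟.Djj j) a u → InE (𝒟.Djj j) a v → InE (𝒟.Djj j) a w → InE (𝒟.Djj j) a p →
    SolvesIntegrated 𝒟 j a ua va wa u v w p → SolvesCellNS 𝒟 j a ua va wa u v w p

/-! ## Step 4 — the compactness assertion (PREDICTED FIRST FAILING STEP) -/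

/-- A sequence `f : ℕ → (ℝ → ℝ³ → ℝ)` HAS A `‖·‖`-CAUCHY SUBSEQUENCE on `[a,a+1] × D`: some subsequence
`f ∘ φ` satisfies `‖f_{φ m} − f_{φ n}‖ ≤ δ` (pointwise ball `NormLe` of the difference) for `m, n` large.
[cite: GeorgievDavidi2018, compactness sentence p.12 l.9–11] -/
def HasNormCauchySubseq (D : Set (EuclideanSpace ℝ (Fin 3))) (a : ℝ)
    (f : ℕ → ℝ → EuclideanSpace ℝ (Fin 3) → ℝ) : Prop :=
  ∃ φ : ℕ → ℕ, StrictMono φ ∧ ∀ δ : ℝ, 0 < δ → ∃ N : ℕ, ∀ m n : ℕ, N ≤ m → N ≤ n →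
    NormLe D a (fun t x => f (φ m) t x - f (φ n) t x) δ

/-- The `‖·‖`-ball of radius `R` in the class `E(K, [a,a+1])` IS (RELATIVELY) COMPACT, in the only form the
print's assertion can take for a subset of the COMPLETION `X̃` (p.11 l.49): every sequence of functions of
`E` supported in the core `K`, with `‖f_n‖ ≤ R` over `[a,a+1] × D`, has a `‖·‖`-Cauchy subsequence (total
boundedness; for the closed ball of the complete space `X̃` this is equivalent to compactness, and it is
IMPLIED by the printed sentence). [cite: GeorgievDavidi2018, p.12 l.9–11; p.18 l.61] -/
def BallCompact (D K : Set (EuclideanSpace ℝ (Fin 3))) (a R : ℝ) : Prop :=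
  ∀ f : ℕ → ℝ → EuclideanSpace ℝ (Fin 3) → ℝ, (∀ n, InE K a (f n)) → (∀ n, NormLe D a (f n) R) →
    HasNormCauchySubseq D a f

/-- The compactness assertion AT one cell `j`, one admissible `ε` and one interval `[a,a+1]`: «X¹ is a compact
subset of Y¹ and Y¹ is a compact subset of C¹([0,1],C₀²(D_j))» (p.12 l.9–11), «X² is a compact subset of Y²»
(p.18 l.61) — both balls, radii `M_{1j}` and `(1+ε)M_{1j}`. [cite: GeorgievDavidi2018, p.12 l.9–11; p.18 l.61] -/
def CompactAt (𝒟 : Decomposition) (j : ℕ) (ε a : ℝ) : Prop :=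
  BallCompact (𝒟.D j) (𝒟.Djj j) a (M 𝒟 j) ∧ BallCompact (𝒟.D j) (𝒟.Djj j) a ((1 + ε) * M 𝒟 j)

/-- **Step 4 — the compactness sentence** p.12 l.9–11 (+ p.18 l.61), for every admissible decomposition, datum,
cell, admissible `ε` and interval `[m−1, m]`: «By the construction of X¹ and Y¹, we have that X¹ is a compact
subset of Y¹ and Y¹ is a compact subset of C¹([0,1],C₀²(D_j))». PREDICTED FIRST FAILING STEP (CARD §4; the
hypothesis «Y is a nonempty compact subset of E» of the authors' Theorem 2.3 at its NS instantiation, p.13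
l.40). Cell-grain companion: `Step4Cell`, `step4_of_cell`. [claim: GeorgievDavidi2018, status: disputed]
[cite: GeorgievDavidi2018, p.12 l.9–11; p.18 l.61] -/
def Step4_compact : Prop :=
  ∀ (𝒟 : Decomposition) (U₀ : EuclideanSpace ℝ (Fin 3) → EuclideanSpace ℝ (Fin 3)), DataHyp 𝒟 U₀ →
    ∀ (j : ℕ) (ε : ℝ), EpsAdmissible 𝒟 U₀ j ε → ∀ m : ℕ, CompactAt 𝒟 j ε m

/-- **Step 4 at CELL GRAIN** (HYGIENE 13 companion of `Step4_compact`): the same sentence for an arbitrary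
bounded measurable cell `D` of positive measure with compact core `K ⊆ D`, `K ≠ D`, base point on `∂K`, any
interval `[a,a+1]` and any radius `R > 0` — «By the construction of X and Y … compact» asserts compactness of
such norm-balls from the construction alone. [claim: GeorgievDavidi2018, status: disputed]
[cite: GeorgievDavidi2018, p.12 l.9–11; p.18 l.61] -/
def Step4Cell : Prop :=
  ∀ (D K : Set (EuclideanSpace ℝ (Fin 3))) (b : EuclideanSpace ℝ (Fin 3)) (a R : ℝ),
    Bornology.IsBounded D → MeasurableSet D → 0 < volume D → IsCompact K → K ⊆ D → K ≠ D →
    b ∈ frontier K → 0 < R → BallCompact D K a R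

/-! ## Step 5 — `S` maps `X⁴` into `Y⁴`, continuously -/

/-- The operator quadruple `S^{mj} = (S_1, S_2, S_3, S_4)`, `S_k(u,v,w,p) = −ε·(k-th component) + ε I^{mj}_k(u,v,w,p)`
(p.12 l.13–33; p.18 l.63 – p.19), returned as the four scalar fields.
[cite: GeorgievDavidi2018, S^{1j} p.12 l.13–33] -/
def Sop (𝒟 : Decomposition) (j : ℕ) (ε a : ℝ) (ua va wa : EuclideanSpace ℝ (Fin 3) → ℝ)
    (u v w p : ℝ → EuclideanSpace ℝ (Fin 3) → ℝ) : Fin 4 → ℝ → EuclideanSpace ℝ (Fin 3) → ℝ :=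
  ![fun t x => -ε * u t x + ε * Iop1 (𝒟.base j) a ua u v w p t x,
    fun t x => -ε * v t x + ε * Iop2 (𝒟.base j) a va u v w p t x,
    fun t x => -ε * w t x + ε * Iop3 (𝒟.base j) a wa u v w p t x,
    fun t x => -ε * p t x + ε * Iop4 (𝒟.base j) a u v w t x]

/-- An INITIAL SLICE for the interval `[a,a+1]` on cell `j`: a `C²` function supported in the core with
`|g|, |g_x|, |g_xx|, … ≤ M_{1j}` on `D_j` — for `a = 0` the data components (Thm 1.1 hypotheses), for `a = m−1 ≥ 1`
the previous solution's final slice `u_{m−1}(m−1,·)` (p.16 l.9–12, p.18 l.50); for `a = 0` read «the data components»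
as the zero-extensions of `u₀|_{D_j}, v₀|_{D_j}, w₀|_{D_j}` (functions of `E¹` live on `D_j`).
[cite: GeorgievDavidi2018, (3.8) data p.16 l.9–12; X̃² p.18 l.30–50] -/
def InSlice (𝒟 : Decomposition) (j : ℕ) (g : EuclideanSpace ℝ (Fin 3) → ℝ) : Prop :=
  ContDiff ℝ 2 g ∧ (∀ x, x ∉ 𝒟.Djj j → g x = 0) ∧
    ∀ x ∈ 𝒟.D j, |g x| ≤ M 𝒟 j ∧ ∀ k : Fin 3, |pd k g x| ≤ M 𝒟 j ∧ |pd k (pd k g) x| ≤ M 𝒟 j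

/-- `S^{mj}` MAPS `X⁴` INTO `Y⁴` AND IS CONTINUOUS at cell `j`, parameter `ε`, interval `[a,a+1]`, slices
`(ua,va,wa)`: for `u,v,w,p ∈ X`, each `S_k(u,v,w,p) ∈ Y` (p.13 l.10–17 «Therefore, for (u,v,w,p) ∈ X¹ we have
that S^{1j}_i(u,v,w,p) ∈ Y¹, i = 1,2,3,4 … and it is continuous»), continuity typed sequentially in `‖·‖`.
[cite: GeorgievDavidi2018, p.12 l.34 – p.13 l.17] -/
def MapsAt (𝒟 : Decomposition) (j : ℕ) (ε a : ℝ) (ua va wa : EuclideanSpace ℝ (Fin 3) → ℝ) : Prop :=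
  (∀ u v w p : ℝ → EuclideanSpace ℝ (Fin 3) → ℝ,
      InX 𝒟 j a u → InX 𝒟 j a v → InX 𝒟 j a w → InX 𝒟 j a p →
        ∀ k : Fin 4, InY 𝒟 j ε a (Sop 𝒟 j ε a ua va wa u v w p k)) ∧
  ∀ (un vn wn pn : ℕ → ℝ → EuclideanSpace ℝ (Fin 3) → ℝ) (u v w p : ℝ → EuclideanSpace ℝ (Fin 3) → ℝ),
    (∀ n, InX 𝒟 j a (un n) ∧ InX 𝒟 j a (vn n) ∧ InX 𝒟 j a (wn n) ∧ InX 𝒟 j a (pn n)) →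
    InX 𝒟 j a u → InX 𝒟 j a v → InX 𝒟 j a w → InX 𝒟 j a p →
    (∀ δ : ℝ, 0 < δ → ∃ N : ℕ, ∀ n, N ≤ n →
      NormLe (𝒟.D j) a (fun t x => un n t x - u t x) δ ∧ NormLe (𝒟.D j) a (fun t x => vn n t x - v t x) δ ∧
      NormLe (𝒟.D j) a (fun t x => wn n t x - w t x) δ ∧ NormLe (𝒟.D j) a (fun t x => pn n t x - p t x) δ) →
    ∀ k : Fin 4, ∀ δ : ℝ, 0 < δ → ∃ N : ℕ, ∀ n, N ≤ n →
      NormLe (𝒟.D j) a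
        (fun t x => Sop 𝒟 j ε a ua va wa (un n) (vn n) (wn n) (pn n) k t x -
          Sop 𝒟 j ε a ua va wa u v w p k t x) δ

/-- **Step 5 — choice of `ε` and the mapping estimates** (p.12 l.1–4; p.12 l.34 – p.13 l.17; p.19): for
every admissible decomposition, datum and cell there is an admissible `ε` («We take ε > 0 so that
ε(3M²+6M+N)(μ(D_j))² ≤ M») such that on every interval `[m−1,m]` and for all initial slices,
`‖I^{mj}_1(u,v,w,p)‖ ≤ (3M²+5M+N)(μ(D_j))²`, hence `‖S^{mj}_k‖ ≤ (1+ε)M`, «S^{mj}: X⁴ → Y⁴ and it is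
continuous». [claim: GeorgievDavidi2018, status: disputed]
[cite: GeorgievDavidi2018, p.12 l.1–4; p.12 l.34 – p.13 l.17; p.19] -/
def Step5_mapsInto : Prop :=
  ∀ (𝒟 : Decomposition) (U₀ : EuclideanSpace ℝ (Fin 3) → EuclideanSpace ℝ (Fin 3)), DataHyp 𝒟 U₀ →
    ∀ j : ℕ, ∃ ε : ℝ, EpsAdmissible 𝒟 U₀ j ε ∧
      ∀ (m : ℕ) (ua va wa : EuclideanSpace ℝ (Fin 3) → ℝ),
        InSlice 𝒟 j ua → InSlice 𝒟 j va → InSlice 𝒟 j wa → MapsAt 𝒟 j ε m ua va wa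

/-! ## Step 6 — the fixed point on one cell and one interval (application of Theorem 2.3) -/

/-- There is a FIXED POINT of `T^{mj} + S^{mj}` in `X⁴`, i.e. (p.13 l.40 – p.14 l.8: `(1+ε)u₁ − εu₁ + εI^{1j}_1 =
u₁ … whereupon I^{1j}_k(u₁,v₁,w₁,p₁) = 0`) a solution of the integrated system in `X⁴`, at cell `j`, interval
`[a,a+1]`, slices `(ua,va,wa)`. [cite: GeorgievDavidi2018, p.13 l.40 – p.14 l.8; p.19 l.48 – p.20 l.22] -/
def FixedPointAt (𝒟 : Decomposition) (j : ℕ) (a : ℝ) (ua va wa : EuclideanSpace ℝ (Fin 3) → ℝ) : Prop :=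
  ∃ u v w p : ℝ → EuclideanSpace ℝ (Fin 3) → ℝ,
    InX 𝒟 j a u ∧ InX 𝒟 j a v ∧ InX 𝒟 j a w ∧ InX 𝒟 j a p ∧ SolvesIntegrated 𝒟 j a ua va wa u v w p

/-- **Step 6 — «From here and from Theorem 2.3, it follows that the operator T^{1j}+S^{1j} has a fixed point
(u₁,v₁,w₁,p₁) in X¹×X¹×X¹×X¹»** (p.13 l.18–42; p.19 – p.20 l.22 for m = 2): with `T = (1+ε)·id`
(«expansive with constant 1+ε», «onto» `Y⁴`, p.13 l.18–38), the compactness of Step 4 and the mapping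
property of Step 5 give, by Theorem 2.3, the fixed point. Typed as the printed INFERENCE at each cell /
admissible `ε` / interval / slices (IMPLICIT content: `E` Banach for the norm `‖·‖`, and the hypothesis
«{x − z : x ∈ X, z ∈ S(X)} ⊂ Y» of Theorem 2.3, neither verified in print).
[claim: GeorgievDavidi2018, status: disputed] [cite: GeorgievDavidi2018, p.13 l.18–42; p.19 – p.20 l.22] -/
def Step6_fixedPoint : Prop :=
  Theorem23 →
    ∀ (𝒟 : Decomposition) (U₀ : EuclideanSpace ℝ (Fin 3) → EuclideanSpace ℝ (Fin 3)), DataHyp 𝒟 U₀ →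
      ∀ (j : ℕ) (ε : ℝ), EpsAdmissible 𝒟 U₀ j ε → ∀ (m : ℕ) (ua va wa : EuclideanSpace ℝ (Fin 3) → ℝ),
        InSlice 𝒟 j ua → InSlice 𝒟 j va → InSlice 𝒟 j wa →
        CompactAt 𝒟 j ε m → MapsAt 𝒟 j ε m ua va wa → FixedPointAt 𝒟 j m ua va wa

/-! ## Step 7 — time stepping and gluing on one cell -/

/-- A GLOBAL CELL SOLUTION on `[0,∞) × D_j` from the datum (p.22 l.34 – p.23 l.19: «(u^j,v^j,w^j,p^j) …
belongs to (C¹([0,∞),C₀²(D_j)))⁴ and it is a solution to the problem (3.2)»): scalar fields, `C¹` in `(t,x)`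
on `[0,∞)×ℝ³`, on every `[m,m+1]` in the class `X` of cell `j` (so supported in `D_jj`, norm ≤ `M_j`), solving
the cell system classically on every `(m,m+1] × D_j`, with the data components at `t = 0` and continuous
matching at `t = m`. [cite: GeorgievDavidi2018, p.22 l.34 – p.23 l.19] -/
def CellGlobalAt (𝒟 : Decomposition) (U₀ : EuclideanSpace ℝ (Fin 3) → EuclideanSpace ℝ (Fin 3))
    (j : ℕ) : Prop :=
  ∃ u v w p : ℝ → EuclideanSpace ℝ (Fin 3) → ℝ,
    ContDiffOn ℝ 1 (Function.uncurry u) (Ici 0 ×ˢ univ) ∧ ContDiffOn ℝ 1 (Function.uncurry v) (Ici 0 ×ˢ univ) ∧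
    ContDiffOn ℝ 1 (Function.uncurry w) (Ici 0 ×ˢ univ) ∧ ContDiffOn ℝ 1 (Function.uncurry p) (Ici 0 ×ˢ univ) ∧
    (∀ m : ℕ, InX 𝒟 j m u ∧ InX 𝒟 j m v ∧ InX 𝒟 j m w ∧ InX 𝒟 j m p ∧
      SolvesCellNS 𝒟 j m (u m) (v m) (w m) u v w p) ∧
    ∀ x ∈ 𝒟.D j, u 0 x = U₀ x 0 ∧ v 0 x = U₀ x 1 ∧ w 0 x = U₀ x 2

/-- **Step 7 — time stepping and C¹-gluing** (p.14 l.9–11; p.16 l.1 – p.23 l.19): with Lemma 3.2 turning each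
fixed point into a solution of (3.2)/(3.8) on `[m−1,m] × D_j`, the solutions for `m = 1, 2, 3, …` (data: the
components of `U₀`, then the previous final slice) match with their first and second derivatives at
`t = 1, 2, …` (p.20 l.25 – p.21 l.30) and «Consequently» glue to a global cell solution (p.22 l.19 – p.23
l.19: «and so on»). Typed as the printed inference. [claim: GeorgievDavidi2018, status: disputed]
[cite: GeorgievDavidi2018, p.14 l.9–11; p.16 l.1 – p.23 l.19] -/
def Step7_gluing : Prop :=
  Lemma32 →
    ∀ (𝒟 : Decomposition) (U₀ : EuclideanSpace ℝ (Fin 3) → EuclideanSpace ℝ (Fin 3)), DataHyp 𝒟 U₀ →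
      ∀ (j : ℕ) (ε : ℝ), EpsAdmissible 𝒟 U₀ j ε →
        (∀ (m : ℕ) (ua va wa : EuclideanSpace ℝ (Fin 3) → ℝ),
          InSlice 𝒟 j ua → InSlice 𝒟 j va → InSlice 𝒟 j wa → FixedPointAt 𝒟 j m ua va wa) →
        CellGlobalAt 𝒟 U₀ j

/-! ## Step 8 — spatial patching -/

/-- **Step 8 — patching the cells** (p.23 l.20 – p.24 l.1): the cell solutions, vanishing with all derivatives
on `∂D_j` (p.23 l.20–34), define `(u,v,w,p)` on `[0,∞)×ℝ³` cell by cell; «is a solution to the problem (1.1)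
which belongs to the space (C²([0,∞)×ℝ³))⁴. Using the system (1.1) we have that (u,v,w,p) ∈
(C^∞([0,∞)×ℝ³))⁴», `supp ⊂ D₁₁ ∪ D₂₂ ∪ …`, and `∫_{ℝ³}|u(t,·)|² = Σ_j ∫_{D_j}|u^j(t,·)|² ≤ Σ_j (…) < ∞` for
every `t` (p.23 l.53 ff.) — i.e. the CONCLUSION of Theorem 1.1. Typed as the printed inference.
[claim: GeorgievDavidi2018, status: disputed] [cite: GeorgievDavidi2018, p.23 l.20 – p.24 l.1] -/
def Step8_patching : Prop :=
  ∀ (𝒟 : Decomposition) (U₀ : EuclideanSpace ℝ (Fin 3) → EuclideanSpace ℝ (Fin 3)), DataHyp 𝒟 U₀ →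
    (∀ j : ℕ, CellGlobalAt 𝒟 U₀ j) → Conclusion 𝒟 U₀

/-! ## Composition -/

/-- `M_{1j} > 0` (the cells are bounded, hence of finite measure, and of positive measure).
[cite: GeorgievDavidi2018, M_{1j} p.11 l.52–54] -/
theorem M_pos (𝒟 : Decomposition) (j : ℕ) : 0 < M 𝒟 j := by
  have hfin : volume (𝒟.D j) < ⊤ := (𝒟.bounded j).measure_lt_top
  have hpos : 0 < (volume (𝒟.D j)).toReal := ENNReal.toReal_pos (𝒟.vol_pos j).ne' hfin.ne
  unfold M
  exact one_div_pos.mpr (mul_pos (pow_pos two_pos _) (Real.sqrt_pos.mpr hpos))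

/-- The cell-grain Step 4 implies the instance-level Step 4 (every cell of an admissible decomposition is an
admissible cell, both radii are positive). [cite: GeorgievDavidi2018, p.12 l.9–11] -/
theorem step4_of_cell (h : Step4Cell) : Step4_compact := by
  intro 𝒟 U₀ _ j ε hε m
  have hM : 0 < M 𝒟 j := M_pos 𝒟 j
  have hM' : 0 < (1 + ε) * M 𝒟 j := mul_pos (by linarith [hε.1]) hM
  exact ⟨h _ _ _ _ _ (𝒟.bounded j) (𝒟.measurable j) (𝒟.vol_pos j) (𝒟.compact j) (𝒟.core_sub j)
      (𝒟.core_ne j) (𝒟.base_mem j) hM,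
    h _ _ _ _ _ (𝒟.bounded j) (𝒟.measurable j) (𝒟.vol_pos j) (𝒟.compact j) (𝒟.core_sub j)
      (𝒟.core_ne j) (𝒟.base_mem j) hM'⟩

/-- **KERNEL COMPOSITION** — the paper's logic composes: Theorem 2.2 (Step 1) gives Theorem 2.3 (Step 2); on
each cell, Step 5 chooses `ε` and gives the mapping property on every interval, Step 4 the compactness, Step 6
the fixed points, Step 7 (with Lemma 3.2 = Step 3) the global cell solution, Step 8 the patched solution of
(1.1). Pure logic; nothing is asserted. [cite: GeorgievDavidi2018, §3 pp.6–24] -/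
theorem claim_of_steps (h1 : Theorem22) (h2 : Theorem23_of_22) (h3 : Lemma32) (h4 : Step4_compact)
    (h5 : Step5_mapsInto) (h6 : Step6_fixedPoint) (h7 : Step7_gluing) (h8 : Step8_patching) :
    ClaimedTheorem := by
  intro 𝒟 U₀ hD
  refine h8 𝒟 U₀ hD fun j => ?_
  obtain ⟨ε, hε, hmaps⟩ := h5 𝒟 U₀ hD j
  exact h7 h3 𝒟 U₀ hD j ε hε fun m ua va wa hua hva hwa =>
    h6 (h2 h1) 𝒟 U₀ hD j ε hε m ua va wa hua hva hwa (h4 𝒟 U₀ hD j ε hε m)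
      (hmaps m ua va wa hua hva hwa)

/-- With the cell-grain Step 4 in place of the instance-level one. [cite: GeorgievDavidi2018, §3 pp.6–24] -/
theorem claim_of_steps_cell (h1 : Theorem22) (h2 : Theorem23_of_22) (h3 : Lemma32) (h4 : Step4Cell)
    (h5 : Step5_mapsInto) (h6 : Step6_fixedPoint) (h7 : Step7_gluing) (h8 : Step8_patching) :
    ClaimedTheorem :=
  claim_of_steps h1 h2 h3 (step4_of_cell h4) h5 h6 h7 h8


/-! ## Step 1 — Theorem 2.2 (Xiang–Yuan's expansive Krasnosel'skii theorem) PROVED (D-0026 in-file discharge) -/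

section Theorem22Discharge

open _root_.Metric

namespace Theorem22Proof

variable {E : Type} [NormedAddCommGroup E]

/-- **Inverse Lipschitz estimate for `I - T` on `X`**: if `T` is expansive on `X` with constant `h > 1`,
then `(h-1)‖x - x'‖ ≤ ‖(x - T x) - (x' - T x')‖` for `x, x' ∈ X` (triangle inequality). [folklore] -/
private theorem sub_le_of_expansive {T : E → E} {X : Set E} {h : ℝ}
    (hT : ∀ x ∈ X, ∀ y ∈ X, h * dist x y ≤ dist (T x) (T y)) {x x' : E} (hx : x ∈ X) (hx' : x' ∈ X) :
    (h - 1) * ‖x - x'‖ ≤ ‖(x - T x) - (x' - T x')‖ := by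
  have h1 := hT x hx x' hx'
  rw [dist_eq_norm, dist_eq_norm] at h1
  have h2 : ‖T x - T x'‖ ≤ ‖(x - T x) - (x' - T x')‖ + ‖x - x'‖ := by
    have e : T x - T x' = (x - x') - ((x - T x) - (x' - T x')) := by abel
    rw [e]
    exact (norm_sub_le _ _).trans (by rw [add_comm])
  linarith

end Theorem22Proof

open Theorem22Proof in
/-- **Theorem 2.2 holds** (p.5 l.3–12, quoted from [7] = Xiang–Yuan 2009, Thm 2.4 — the expansive
Krasnosel'skii fixed-point theorem), PROVED as typed: `X` nonempty closed convex in a Banach space `E`,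
`S` continuous on `X` with `S(X)` inside a compact set, `T` expansive on `X` (constant `h > 1`), and
condition 3 in either printed form; then `S + T` has a fixed point in `X`. Proof: for `y ∈ X` the equation
`x = T x + S y` has a solution `x = N y ∈ X` (condition 3), unique in `X` by expansiveness; the inverse
estimate `(h-1)‖N y − N y'‖ ≤ ‖S y − S y'‖` makes `N` continuous on `X` with `N(X)` totally bounded (it is
controlled by `S(X) ⊆ K`), hence relatively compact (`E` complete), and Schauder's fixed point theorem
(tree `Literature.Analysis.Convex.exists_fixedPoint_of_isCompact_closure`, PROVED) gives `y = N y`, i.e.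
`y = T y + S y`. In-file discharge (D-0026) of the quoted INPUT of the skeleton; the row's verdict (#38 C31:
false lemma @ `Step4_compact`, p.12) is untouched. [cite: GeorgievDavidi2018, Thm 2.2 p.5 l.3–12] -/
theorem theorem22_holds : Theorem22 := by
  intro E _ _ _ X T S hne hXcl hXconv hS hK hT h3
  haveI : Nonempty E := ⟨hne.some⟩
  obtain ⟨K, hKc, hSK⟩ := hK
  obtain ⟨h, h1, hT⟩ := hT
  have hh1 : 0 < h - 1 := by linarith
  -- (A) solvability in `X` of `x = T x + S y` for `y ∈ X`
  have hsolv : ∀ y ∈ X, ∃ x ∈ X, x = T x + S y := by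
    intro y hy
    rcases h3 with ⟨hsub, hcl⟩ | hsub
    · obtain ⟨x, -, hx⟩ := hsub (mem_image_of_mem S hy)
      have hx' : x = T x + S y := sub_eq_iff_eq_add'.1 hx
      exact ⟨x, hcl x y hy hx', hx'⟩
    · obtain ⟨x, hxX, hx⟩ := hsub (mem_image_of_mem S hy)
      exact ⟨x, hxX, sub_eq_iff_eq_add'.1 hx⟩
  choose! N hNX hNeq using hsolv
  have hNsub : ∀ y ∈ X, N y - T (N y) = S y := fun y hy =>
    sub_eq_iff_eq_add'.2 (hNeq y hy)
  -- (B) the inverse estimate `(h-1)‖N y - N y'‖ ≤ ‖S y - S y'‖` on `X`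
  have hNlip : ∀ y ∈ X, ∀ y' ∈ X, ‖N y - N y'‖ ≤ ‖S y - S y'‖ / (h - 1) := by
    intro y hy y' hy'
    have e := sub_le_of_expansive hT (hNX y hy) (hNX y' hy')
    rw [hNsub y hy, hNsub y' hy'] at e
    rw [le_div_iff₀ hh1, mul_comm]
    exact e
  -- (C) `N` is continuous on `X` and maps `X` into `X`
  have hNcont : ContinuousOn N X := by
    rw [Metric.continuousOn_iff]
    intro y hy ε hε
    obtain ⟨δ, hδ, hSδ⟩ := Metric.continuousOn_iff.1 hS y hy ((h - 1) * ε) (mul_pos hh1 hε)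
    refine ⟨δ, hδ, fun y' hy' hd => ?_⟩
    rw [dist_eq_norm]
    have h2 := hSδ y' hy' hd
    rw [dist_eq_norm] at h2
    calc ‖N y' - N y‖ ≤ ‖S y' - S y‖ / (h - 1) := hNlip y' hy' y hy
      _ < (h - 1) * ε / (h - 1) := by gcongr
      _ = ε := by field_simp
  have hNmaps : MapsTo N X X := fun y hy => hNX y hy
  -- (D) `N(X)` is totally bounded, hence relatively compact
  have htb : TotallyBounded (N '' X) := by
    rw [Metric.totallyBounded_iff]
    intro ε hε
    have hStb : TotallyBounded (S '' X) := hKc.totallyBounded.subset hSK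
    obtain ⟨t₀, ht₀S, ht₀fin, ht₀cov⟩ :=
      finite_approx_of_totallyBounded hStb ((h - 1) * (ε / 2)) (by positivity)
    have hpre : ∀ z ∈ t₀, ∃ y ∈ X, S y = z := fun z hz => (mem_image _ _ _).1 (ht₀S hz)
    choose! g hgX hgS using hpre
    refine ⟨(fun z => N (g z)) '' t₀, ht₀fin.image _, fun w hw => ?_⟩
    obtain ⟨y, hy, rfl⟩ := hw
    obtain ⟨z, hz, hyz⟩ : ∃ z ∈ t₀, S y ∈ ball z ((h - 1) * (ε / 2)) := by
      simpa only [mem_iUnion, exists_prop] using ht₀cov (mem_image_of_mem S hy)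
    refine mem_iUnion₂.2 ⟨N (g z), mem_image_of_mem _ hz, ?_⟩
    rw [mem_ball, dist_eq_norm]
    rw [mem_ball, dist_eq_norm] at hyz
    calc ‖N y - N (g z)‖ ≤ ‖S y - S (g z)‖ / (h - 1) := hNlip y hy (g z) (hgX z hz)
      _ = ‖S y - z‖ / (h - 1) := by rw [hgS z hz]
      _ < (h - 1) * (ε / 2) / (h - 1) := by gcongr
      _ = ε / 2 := by field_simp
      _ < ε := by linarith
  have hcomp : IsCompact (closure (N '' X)) := htb.closure.isCompact_of_isClosed isClosed_closure
  -- (E) Schauder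
  obtain ⟨y, hyX, hNy⟩ :=
    Literature.Analysis.Convex.exists_fixedPoint_of_isCompact_closure hXconv hXcl hne hNcont hNmaps hcomp
  refine ⟨y, hyX, ?_⟩
  have e := hNeq y hyX
  rw [hNy] at e
  rw [add_comm]
  exact e.symm

/-! ## Step 2 — Theorem 2.3 (and hence `Theorem23_of_22`) PROVED -/

/-- **Theorem 2.3 holds** (p.5 l.15–25), PROVED as typed — and by the printed route «a consequence of
Theorem 2.2» (proof p.5 l.27 – p.6 l.25): under the hypotheses of Theorem 2.3, for `z ∈ S(X)` the map
`G y = T⁻¹(y − z)` sends `X` into `X` (`y − z ∈ Y = T(X)`) and is a strict contraction (`T` expansive,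
`h > 1`), so it has a fixed point in the compact set `X` (minimise `‖G y − y‖`), i.e. `x − T x = z` is
solvable in `X`: condition 3 of Theorem 2.2 in the form `S(X) ⊂ (I−T)(X)`; Theorem 2.2 (`theorem22_holds`)
then gives the fixed point of `T + S`. In-file discharge (D-0026); the row's verdict (#38 C31: false lemma @
`Step4_compact`, p.12) is untouched. [cite: GeorgievDavidi2018, Thm 2.3 p.5 l.15–25 and proof p.5 l.27 – p.6 l.25] -/
theorem theorem23_holds : Theorem23 := by
  intro E _ _ _ X Y T S hne hXcl hXconv hYc hXY _hYX hS hSY _hL hT hTXY hdiff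
  have hXc : IsCompact X := hYc.of_isClosed_subset hXcl hXY
  -- condition 3 of Theorem 2.2, second form: `S(X) ⊆ (I - T)(X)`
  have hcond : S '' X ⊆ (fun x => x - T x) '' X := by
    intro z hz
    obtain ⟨h, h1, hTexp⟩ := hT
    have hh0 : 0 < h := by linarith
    -- a right inverse of `T` from `Y` into `X`
    have hinv : ∀ w ∈ Y, ∃ p ∈ X, T p = w := fun w hw => by
      have hw' : w ∈ T '' X := hTXY ▸ hw
      exact (mem_image _ _ _).1 hw'
    choose! p hpX hpT using hinv
    set G : E → E := fun y => p (y - z) with hG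
    have hGX : ∀ y ∈ X, G y ∈ X := fun y hy => hpX _ (hdiff y hy z hz)
    have hTG : ∀ y ∈ X, T (G y) = y - z := fun y hy => hpT _ (hdiff y hy z hz)
    -- `G` is a contraction on `X`: `h‖G y − G y'‖ ≤ ‖y − y'‖`
    have hGlip : ∀ y ∈ X, ∀ y' ∈ X, h * ‖G y - G y'‖ ≤ ‖y - y'‖ := by
      intro y hy y' hy'
      have e := hTexp (G y) (hGX y hy) (G y') (hGX y' hy')
      rw [dist_eq_norm, dist_eq_norm, hTG y hy, hTG y' hy', sub_sub_sub_cancel_right] at e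
      exact e
    -- continuity of `y ↦ ‖G y − y‖` on `X`
    have hGcont : ContinuousOn G X := by
      rw [Metric.continuousOn_iff]
      intro y hy ε hε
      refine ⟨ε, hε, fun y' hy' hd => ?_⟩
      rw [dist_eq_norm] at hd ⊢
      have e := hGlip y' hy' y hy
      have : ‖G y' - G y‖ ≤ ‖y' - y‖ := by
        have : ‖G y' - G y‖ ≤ h * ‖G y' - G y‖ := le_mul_of_one_le_left (norm_nonneg _) h1.le
        exact this.trans e
      exact this.trans_lt hd
    have hφ : ContinuousOn (fun y => ‖G y - y‖) X := (hGcont.sub continuousOn_id).norm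
    obtain ⟨y₀, hy₀X, hmin⟩ := hXc.exists_isMinOn hne hφ
    -- the minimiser is a fixed point of `G`
    have hfix : G y₀ = y₀ := by
      by_contra hne'
      have hpos : 0 < ‖G y₀ - y₀‖ := norm_pos_iff.2 (sub_ne_zero.2 hne')
      have hle : ‖G y₀ - y₀‖ ≤ ‖G (G y₀) - G y₀‖ := hmin (hGX y₀ hy₀X)
      have hcontr : h * ‖G (G y₀) - G y₀‖ ≤ ‖G y₀ - y₀‖ := hGlip (G y₀) (hGX y₀ hy₀X) y₀ hy₀X
      nlinarith [norm_nonneg (G (G y₀) - G y₀)]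
    refine ⟨y₀, hy₀X, ?_⟩
    show y₀ - T y₀ = z
    have e := hTG y₀ hy₀X
    rw [hfix] at e
    rw [e]; abel
  obtain ⟨x, hxX, hx⟩ := theorem22_holds E X T S hne hXcl hXconv hS ⟨Y, hYc, hSY⟩ hT (Or.inr hcond)
  exact ⟨x, hxX, by rw [add_comm]; exact hx⟩

/-- `Theorem23` — `_holds` alias of `theorem23_holds` above under the fact's exact name (appended
2026-08-28, D-0026 bookkeeping: the proof term is the existing theorem of this file; no statement,
definition or attribute is edited; no new named fact; the ledger's debt table listed the fact
unproved). [cite: GeorgievDavidi2018, Thm 2.3 p.5 l.15–25 and proof p.5 l.27 – p.6 l.25] -/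
theorem _root_.Literature.Claims.NS.GeorgievDavidi2021.Theorem23_holds : Theorem23 :=
  _root_.Literature.Claims.NS.GeorgievDavidi2021.theorem23_holds

/-- **Step 2 holds**: «The following result is a consequence of Theorem 2.2» (p.5 l.14) — `Theorem22 →
Theorem23`, PROVED (indeed `Theorem23` holds outright, `theorem23_holds`, by the printed contraction route).
[cite: GeorgievDavidi2018, Thm 2.3 and its proof p.5 l.14 – p.6 l.25] -/
theorem theorem23_of_22_holds : Theorem23_of_22 := fun _ => theorem23_holds

/-- `Theorem23_of_22` — `_holds` alias of `theorem23_of_22_holds` above under the fact's exact name (appended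
2026-08-28, D-0026 bookkeeping: the proof term is the existing theorem of this file; no statement,
definition or attribute is edited; no new named fact; the ledger's debt table listed the fact
unproved). [cite: GeorgievDavidi2018, Thm 2.3 and its proof p.5 l.14 – p.6 l.25] -/
theorem _root_.Literature.Claims.NS.GeorgievDavidi2021.Theorem23_of_22_holds : Theorem23_of_22 :=
  _root_.Literature.Claims.NS.GeorgievDavidi2021.theorem23_of_22_holds

end Theorem22Discharge

end

end Literature.Claims.NS.GeorgievDavidi2021
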